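import Mathlib
import HarnessLib
import Literature.Analysis.FluidPDE.Tao2016AveragedNS.LocalCascadeSolutions
import Literature.Analysis.FluidPDE.Tao2016AveragedNS.RenormalisedCascadeWaves
import Literature.Analysis.FluidPDE.Tao2016AveragedNS.SelfSimilarCascadeBlowup
import Literature.Analysis.FluidPDE.Tao2016AveragedNS.ViscousEternalSolutions
import Literature.Analysis.FluidPDE.Tao2016AveragedNS.BoundedEternalSolutions
import Summits.NavierStokesRegularity.NavierStokesRegularity.Theses.TaoLadderRungTwoBreak
import Summits.NavierStokesRegularity.NavierStokesRegularity.Theorems.TaoLadderRungTwoBreakNoSurvivingEternalViscBddOneLinks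

/-!
# Crux K1ᵛ(1) `TaoLadderRungTwoBreak.NoSurvivingEternalViscBddOne` (stmt-NavierStokesRegularity-20419), (ρ+) half:
# for bounded admissible viscous eternal solutions, (S₁)-SURVIVING ⟺ LOUD ON EVERY SHELL — at EVERY scale
# ratio, with no threshold — and loudness lives on or after the dissipation diagonal

MODEL lattice ODEs only (Tao 2016 §4, variables of §6.4); nothing here is a statement about the Navier–Stokes
equations; no summit or rung LEAF is proved (`--supports stmt-NavierStokesRegularity-20419 --as helper`).

* `not_survivingFwd_of_quietShell` — the tree's PROVED dissipation-dominated slice WITHOUT A THRESHOLD: for every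
  `ε₀ > 0`, every E₂(R) table, every `ν̂ > 0`, an admissible viscous eternal solution obeying the type-I bound
  above a shell `n₀` whose a=1-weighted energy stays below a level `< ν̂²/4096` is not forward (S₁)-surviving
  (`tailRecursionAt_4096 R εs` holds for every `εs`; the geometric decay of the ceilings is re-derived here because
  the tree's `quadRecursion_eventually_lt` is private).
* `survivingFwd_iff_loud` — **for a uniformly bounded admissible viscous (`ν̂ > 0`) eternal solution of an E₂(R)
  table at ANY `ε₀ > 0`: forward (S₁)-survival ⟺ every shell `n₀ ≥ 0` is loud** (reaches every level
  `< ν̂²/4096`): ⇐ is `eternalSurvivingFwd_one_of_loud` (Links file, no dynamics), ⇒ is the seeded slice.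
* `exp_two_mul_ge_of_loud` — loudness is LATE: if shell `n` carries weighted energy `> s` at log-time `σ` and
  `‖W‖ ≤ C`, then `s · ((1+ε₀)^4)^n ≤ e^{2σ} C²` — a loud ladder is loud on or after the dissipation diagonal
  `σ ≈ 2n·log(1+ε₀)`, where the covariant viscosity coefficient `ν̂(1+ε₀)^{2n}e^{-σ}` is of order `ν̂`.
* `noLoudLadder_iff_posHalf_sameThreshold` — consequently the (ρ+) stub and the `ν̂ > 0` half of K1ᵛ(1) agree
  threshold-by-threshold (the Links file's `noLoudLadder_iff_posHalf` took a `min` of thresholds).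

HONEST LABEL: structure of the (ρ+) statement (what a loud ladder is and where it lives); the existence question
(are there bounded loud ladders on a fixed-spread table as `ε₀ → 0`? — H = `ViscousBlockDSSWaves` is the named
candidate) is untouched; ⟨20419⟩/⟨20452⟩ stay OPEN.
-/

noncomputable section

-- the summit and its single sub-problem share the name (CONVENTIONS §1)
set_option linter.dupNamespace false

namespace Summit.NavierStokesRegularity.NavierStokesRegularity.Theorems.NoSurvivingEternalViscBddOne

open Set Filter Topology
open Literature.Analysis.FluidPDE Literature.Analysis.FluidPDE.TaoCascade
open Summit.NavierStokesRegularity.NavierStokesRegularity.Theses.TaoLadderRungTwoBreak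

/-- Geometric decay of quadratically recursing ceilings: `S(n+1) ≤ L S(n)²`, `L S(n₀) < 1`, `S ≥ 0` give
`S(n₀ + k) ≤ (L S n₀)^k · S n₀`.
[folklore] -/
theorem ceiling_geometric {S : ℕ → ℝ} {L : ℝ} {n₀ : ℕ} (hL : 0 < L)
    (hS0 : ∀ n, n₀ ≤ n → 0 ≤ S n) (hrec : ∀ n, n₀ ≤ n → S (n + 1) ≤ L * S n ^ 2)
    (hseed : L * S n₀ < 1) : ∀ k : ℕ, S (n₀ + k) ≤ (L * S n₀) ^ k * S n₀ ∧ L * S (n₀ + k) ≤ L * S n₀ := by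
  have hθ0 : 0 ≤ L * S n₀ := mul_nonneg hL.le (hS0 n₀ le_rfl)
  intro k
  induction k with
  | zero => simp
  | succ k ih =>
    obtain ⟨ih1, ih2⟩ := ih
    have hk : n₀ ≤ n₀ + k := Nat.le_add_right _ _
    have hSk0 : 0 ≤ S (n₀ + k) := hS0 _ hk
    have hstep : S (n₀ + (k + 1)) ≤ L * S (n₀ + k) ^ 2 := by
      rw [← Nat.add_assoc]; exact hrec _ hk
    constructor
    · calc S (n₀ + (k + 1)) ≤ L * S (n₀ + k) ^ 2 := hstep
        _ = (L * S (n₀ + k)) * S (n₀ + k) := by ring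
        _ ≤ (L * S n₀) * ((L * S n₀) ^ k * S n₀) :=
            mul_le_mul ih2 ih1 hSk0 hθ0
        _ = (L * S n₀) ^ (k + 1) * S n₀ := by ring
    · calc L * S (n₀ + (k + 1)) ≤ L * (L * S (n₀ + k) ^ 2) := mul_le_mul_of_nonneg_left hstep hL.le
        _ = (L * S (n₀ + k)) * (L * S (n₀ + k)) := by ring
        _ ≤ (L * S n₀) * 1 :=
            mul_le_mul ih2 (ih2.trans hseed.le) (mul_nonneg hL.le hSk0) hθ0
        _ = L * S n₀ := mul_one _

/-- **The dissipation-dominated slice WITHOUT A THRESHOLD.**  For every `ε₀ > 0`, every table of `InTableClass R`,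
every `ν̂ > 0`: an admissible viscous eternal solution obeying the type-I bound above `n₀` whose a=1-weighted
energy on shell `n₀` stays below some `s₀ < ν̂²/4096` at all log-times is not forward (S₁)-surviving.
(The tree's `noSurvivingViscSeededBdd R 4096` hides its — arbitrary — threshold behind `∃ εs`.)
[cite: Tao2016AveragedNS, §4 Lemma 4.1 (4.8)–(4.10), Thm. 4.2 (statement shape), §6.4; tree `tailRecursionAt_4096`] -/
theorem not_survivingFwd_of_quietShell {R ε₀ νh : ℝ} (hε₀ : 0 < ε₀)
    {α : Fin 4 → Fin 4 → Fin 4 → ℤ × ℤ × ℤ → ℝ} (hα : InTableClass R α)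
    {W : ℤ → ℝ → Em 4} (hν : 0 < νh) (hW : IsEternalVisc ε₀ νh α W) {n₀ : ℕ} (hT : TypeIBound W n₀)
    (hquiet : ∃ s₀ : ℝ, s₀ < νh ^ 2 / 4096 ∧ ∀ σ : ℝ, wtEnergy ε₀ W n₀ σ ≤ s₀) :
    ¬ EternalSurvivingFwd 1 ε₀ W := by
  obtain ⟨S, hS, hS0, hrec, hsd⟩ := tailRecursionAt_4096 R ε₀ ε₀ hε₀ le_rfl α hα νh W hν hW n₀ hT hquiet
  have hL : 0 < (4096 : ℝ) / νh ^ 2 := div_pos (by norm_num) (pow_pos hν 2)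
  refine not_surviving_of_ceilings hS fun c hc => ?_
  -- S(n₀ + k) ≤ θ^k S n₀ with θ = L S n₀ < 1
  have hθ0 : 0 ≤ 4096 / νh ^ 2 * S n₀ := mul_nonneg hL.le (hS0 n₀ le_rfl)
  have hlim : Tendsto (fun k : ℕ => (4096 / νh ^ 2 * S n₀) ^ k * S n₀) atTop (𝓝 (0 * S n₀)) :=
    (tendsto_pow_atTop_nhds_zero_of_lt_one hθ0 hsd).mul_const _
  rw [zero_mul] at hlim
  obtain ⟨K, hK⟩ := (hlim.eventually (gt_mem_nhds hc)).exists_forall_of_atTop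
  refine ⟨n₀ + K, fun n hn => ?_⟩
  obtain ⟨k, rfl⟩ : ∃ k, n = n₀ + k := ⟨n - n₀, by omega⟩
  exact lt_of_le_of_lt (ceiling_geometric hL hS0 hrec hsd k).1 (hK k (by omega))

/-- **Surviving ⇒ loud on every shell** (contrapositive of the threshold-free slice, with the type-I bound from
`UniformBound`): every shell `n₀ ≥ 0` reaches every level `< ν̂²/4096`.
[cite: Tao2016AveragedNS, §4 Lemma 4.1 (4.8)–(4.10), §6.4; cell vocabulary] -/
theorem loud_of_survivingFwd {R ε₀ νh : ℝ} (hε₀ : 0 < ε₀)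
    {α : Fin 4 → Fin 4 → Fin 4 → ℤ × ℤ × ℤ → ℝ} (hα : InTableClass R α)
    {W : ℤ → ℝ → Em 4} (hν : 0 < νh) (hW : IsEternalVisc ε₀ νh α W) (hU : UniformBound W)
    (hS : EternalSurvivingFwd 1 ε₀ W) :
    ∀ n₀ : ℕ, ∀ s₀ : ℝ, s₀ < νh ^ 2 / 4096 → ∃ σ : ℝ, s₀ < wtEnergy ε₀ W n₀ σ := by
  intro n₀ s₀ hs₀
  by_contra hno
  push Not at hno
  exact not_survivingFwd_of_quietShell hε₀ hα hν hW (typeIBound_of_uniformBound hU n₀) ⟨s₀, hs₀, hno⟩ hS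

/-- **SURVIVING ⟺ LOUD**, at every scale ratio.  For a uniformly bounded admissible eternal solution with
covariant viscosity `ν̂ > 0` of a table of `InTableClass R`, at any `ε₀ > 0`: forward (S₁)-survival is EQUIVALENT to
loudness of every shell `n₀ ≥ 0` (⇐: `eternalSurvivingFwd_one_of_loud`, pure bookkeeping; ⇒: the quadratic tail
recursion).  This is the structural content of the (ρ+) stub `stub_noLoudLadderOne` of ⟨20419⟩ = ⟨20452⟩.
[cite: Tao2016AveragedNS, §4 Lemma 4.1 (4.8)–(4.10), Thm. 4.2 (statement shape), §6.4; cell vocabulary] -/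
theorem survivingFwd_iff_loud {R ε₀ νh : ℝ} (hε₀ : 0 < ε₀)
    {α : Fin 4 → Fin 4 → Fin 4 → ℤ × ℤ × ℤ → ℝ} (hα : InTableClass R α)
    {W : ℤ → ℝ → Em 4} (hν : 0 < νh) (hW : IsEternalVisc ε₀ νh α W) (hU : UniformBound W) :
    EternalSurvivingFwd 1 ε₀ W ↔
      ∀ n₀ : ℕ, ∀ s₀ : ℝ, s₀ < νh ^ 2 / 4096 → ∃ σ : ℝ, s₀ < wtEnergy ε₀ W n₀ σ :=
  ⟨loud_of_survivingFwd hε₀ hα hν hW hU, eternalSurvivingFwd_one_of_loud hε₀ hν hU⟩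

/-- **Loudness is late (on or after the dissipation diagonal).**  If `‖W_k(σ)‖ ≤ C` uniformly and shell `n`
carries a=1-weighted energy `> s` at log-time `σ`, then `s · ((1+ε₀)^4)^n ≤ e^{2σ} C²`; for the loud level
`s ≈ ν̂²/4096` this reads `σ ≳ 2n·log(1+ε₀) + log(ν̂/(64 C))`, the log-time at which the covariant viscosity
coefficient `ν̂(1+ε₀)^{2n}e^{-σ}` of shell `n` has dropped to order `ν̂·C`.
[cite: Tao2016AveragedNS, §4 Lemma 4.1 (4.8), §6.4 (self-similar variables); cell vocabulary] -/
theorem exp_two_mul_ge_of_loud {ε₀ C s : ℝ} (hε : 0 < ε₀) {W : ℤ → ℝ → Em 4}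
    (hC : ∀ (k : ℤ) (σ : ℝ), ‖W k σ‖ ≤ C) {n : ℕ} {σ : ℝ} (hloud : s < wtEnergy ε₀ W n σ) :
    s * ((1 + ε₀) ^ (4 : ℕ)) ^ n ≤ Real.exp (2 * σ) * C ^ 2 := by
  have hq : 0 < ((1 + ε₀) ^ (4 : ℕ)) ^ n := by positivity
  have h1 := wtEnergy_le_of_uniformBound hε hC n σ
  have h2 : s ≤ (((1 + ε₀) ^ (4 : ℕ))⁻¹) ^ n * (Real.exp (2 * σ) * C ^ 2) := (hloud.le).trans h1
  rw [inv_pow] at h2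
  have h3 := mul_le_mul_of_nonneg_right h2 hq.le
  calc s * ((1 + ε₀) ^ (4 : ℕ)) ^ n
      ≤ (((1 + ε₀) ^ (4 : ℕ)) ^ n)⁻¹ * (Real.exp (2 * σ) * C ^ 2) * ((1 + ε₀) ^ (4 : ℕ)) ^ n := h3
    _ = Real.exp (2 * σ) * C ^ 2 := by field_simp

/-- **(ρ+) and the `ν̂ > 0` half of K1ᵛ(1) agree THRESHOLD BY THRESHOLD**: for every `εs`, «below `εs` no bounded
admissible viscous (`ν̂>0`) eternal solution of an E₂(R) table that is loud on every shell is surviving» ⟺ «below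
`εs` no bounded admissible viscous (`ν̂>0`) eternal solution of an E₂(R) table is surviving».
[cite: Tao2016AveragedNS, §4 Thm. 4.2 (statement shape), §6.4; cell vocabulary] -/
theorem noLoudLadder_iff_posHalf_sameThreshold (R εs : ℝ) :
    (∀ ε₀ : ℝ, 0 < ε₀ → ε₀ ≤ εs →
      ∀ α : Fin 4 → Fin 4 → Fin 4 → ℤ × ℤ × ℤ → ℝ, InTableClass R α →
        ∀ (νh : ℝ) (W : ℤ → ℝ → Em 4), 0 < νh → IsEternalVisc ε₀ νh α W → UniformBound W →
          (∀ n₀ : ℕ, ∀ s₀ : ℝ, s₀ < νh ^ 2 / 4096 → ∃ σ : ℝ, s₀ < wtEnergy ε₀ W n₀ σ) →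
            ¬ EternalSurvivingFwd 1 ε₀ W) ↔
    (∀ ε₀ : ℝ, 0 < ε₀ → ε₀ ≤ εs →
      ∀ α : Fin 4 → Fin 4 → Fin 4 → ℤ × ℤ × ℤ → ℝ, InTableClass R α →
        ∀ (νh : ℝ) (W : ℤ → ℝ → Em 4), 0 < νh → IsEternalVisc ε₀ νh α W → UniformBound W →
          ¬ EternalSurvivingFwd 1 ε₀ W) := by
  constructor
  · intro H ε₀ hε₀ hle α hα νh W hν hW hU hS
    exact H ε₀ hε₀ hle α hα νh W hν hW hU (loud_of_survivingFwd hε₀ hα hν hW hU hS) hS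
  · intro H ε₀ hε₀ hle α hα νh W hν hW hU _
    exact H ε₀ hε₀ hle α hα νh W hν hW hU

end Summit.NavierStokesRegularity.NavierStokesRegularity.Theorems.NoSurvivingEternalViscBddOne

end
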